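import Literature.Probability.Percolation.ArmSeparationUntwistBoundFour
import Literature.Probability.Percolation.ArmSeparationHalfStepBoundFour
import HarnessLib

/-!
# Untwisting the half-turned landing at constant cost, at `p`

Topic `Literature/Probability/Percolation`; family `crit-perc` / near-critical percolation on `𝕋`
(P. Nolin, *Near-critical percolation in two dimensions*, EJP 13 (2008), Thm. 11 for `j = 4`,
`σ = BWBW` [arXiv 0711.4948: Thm. 10]; §4.2 relocation of the landing sequences, §4.3 Prop. 12 (i)
and Lemma 13, §4.4 p. 13). Nolin's Lemma 13 (the generalised FKG inequality
`triSitePercolation_locallyMonotone_fkg`) packages the four simultaneous U-turns of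
`ArmSeparationUntwistFour`: with the shared shell `{r ≤ |v|}`, the increasing region (inside `Λ_r`:
the free spaces of the two open arms of `sepFourArmG r N 3` and their U-turn corridors, and those of
the half turn) and the decreasing region (the same for the two closed arms), whose disjointness is the
lockstep nesting of the four corridors (`uEnv_disjoint`, `uEnv_disjoint_neg`), one gets
`P_p(sepFourArmG r N 3) · c' ≤ P_p(sepFourArmQ (8 ⌊r/64⌋) N)`
(`real_sepFourArmG_three_mul_le_sepFourArmQ_at`). Everything here is proved; no named facts are
introduced.

## References

* P. Nolin, Near-critical percolation in two dimensions, *Electron. J. Probab.* 13 (2008), §4.2–4.4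
  (arXiv 0711.4948: Def. 6–8, Prop. 11, Lemma 12, proof of Thm. 10) [Nolin2008].
* H. Kesten, Scaling relations for 2D-percolation, *Comm. Math. Phys.* 109 (1987), Lemma 2 [Kesten1987].
-/

noncomputable section

open MeasureTheory Set

namespace Literature.Probability.Percolation

open LatticeModels

/-! ### Frame identities -/

/-- `ρ³ = frameIso 3` (the central symmetry). [folklore] -/
theorem rot3_eq_frameIso3 (v : Site 2) : triRotIsoPow 3 v = frameIso 3 v := by
  obtain ⟨-, -, -, -, -, -, f30, f31, -⟩ := frameIso_apply_formula v
  obtain ⟨r30, r31⟩ := rot3_apply v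
  exact Site.eq_iff_two.2 ⟨by rw [f30, r30], by rw [f31, r31]⟩

/-- `frameIso 5` is an involution. [folklore] -/
theorem frameIso_five_five (v : Site 2) : frameIso 5 (frameIso 5 v) = v := by
  obtain ⟨a0, a1⟩ := frameIso5_apply (frameIso 5 v)
  obtain ⟨b0, b1⟩ := frameIso5_apply v
  exact Site.eq_iff_two.2 ⟨by rw [a0, b1]; ring, by rw [a1, b0]; ring⟩

/-- Transport of a path of `κ` to `frameConfig 5 κ`. [folklore] -/
theorem pathIn_frameConfig_five_of {A : Set (Site 2)} {κ : SiteConfig (Site 2)} {x y : Site 2}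
    (h : PathIn triGraph (A ∩ κ) x y) :
    PathIn triGraph ((frameIso 5 '' A) ∩ frameConfig 5 κ) (frameIso 5 x) (frameIso 5 y) := by
  refine (pathIn_map_iso (frameIso 5) h).mono ?_
  rintro _ ⟨v, ⟨hvA, hvκ⟩, rfl⟩
  refine ⟨⟨v, hvA, rfl⟩, ?_⟩
  rw [mem_frameConfig]
  show frameIso 5 (frameIso 5 v) ∈ κ
  rw [frameIso_five_five]; exact hvκ

/-- `rotConfig 3` is an involution. [folklore] -/
theorem rotConfig_three_three (κ : SiteConfig (Site 2)) : rotConfig 3 (rotConfig 3 κ) = κ := by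
  ext v; rw [mem_rotConfig, mem_rotConfig, rot3_rot3]

/-! ### The arms of the target -/

/-- The old join region of a landed arm of `sepArmGen r N 3` and the region of its open U-turn lie,
after the half turn, in the join region of the target arm. [folklore] -/
theorem rot3_mem_sepJoinRegion {r N : ℕ} (hr : 4096 ≤ r) (hrN : 2 * r ≤ N) {z zo : Site 2} (hz : z ∈ sepLanding r) {y : Site 2}
    (hy : y ∈ uRegA r ∪ (triAnnulusSet r N ∪ frameIso 3 '' triOpenBall zo (N / 8) ∪ triOpenBall z (r / 8))) :
    triRotIsoPow 3 y ∈ sepJoinRegion (8 * (r / 64)) N zo ![((8 * (r / 64) : ℕ) : ℤ), -((8 * (r / 64) / 2 : ℕ) : ℤ)] := by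
  have hn : triNorm (triRotIsoPow 3 y) = triNorm y := triNorm_rot 3 y
  have hrNz : 2 * (r : ℤ) ≤ N := by exact_mod_cast hrN
  have h8 : 8 * (r / 64) / 8 = r / 64 := by omega
  obtain ⟨q0, q1⟩ := rot3_apply y
  rcases hy with hy | (hy | ⟨x, hx, rfl⟩) | hy
  · rcases hy with hy | hy
    · refine Or.inl (Or.inl (mem_triAnnulusSet.2 ⟨by rw [hn]; exact hy.1, by rw [hn]; have := hy.2; omega⟩))
    · refine Or.inr ?_
      rw [h8]
      rw [mem_triOpenBall, triNorm_lt_iff_lin] at hy ⊢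
      obtain ⟨c0, c1⟩ := rot3_apply ![((8 * (r / 64) : ℕ) : ℤ), -((8 * (r / 64) / 2 : ℕ) : ℤ)]
      simp only [Pi.sub_apply, c0, c1] at hy
      simp only [Pi.sub_apply, q0, q1]
      omega
  · rw [mem_triAnnulusSet] at hy
    exact Or.inl (Or.inl (mem_triAnnulusSet.2 ⟨by rw [hn]; have := hy.1; omega, by rw [hn]; exact hy.2⟩))
  · rw [show triRotIsoPow 3 ((frameIso 3 : triGraph ≃g triGraph) x) = x from by
      rw [rot3_eq_frameIso3]; exact frameIso_three_three x]
    exact Or.inl (Or.inr hx)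
  · have hzL := hz; rw [mem_sepLanding] at hzL
    rw [mem_triOpenBall, triNorm_lt_iff_lin] at hy
    simp only [Pi.sub_apply] at hy
    refine Or.inl (Or.inl (mem_triAnnulusSet.2 ⟨?_, ?_⟩))
    · rw [hn]; exact le_triNorm_iff_lin.2 (Or.inl (by omega))
    · rw [hn]; exact triNorm_le_iff_lin.2 (by omega)

/-- **The open arm of `sepFourArmG r N 3` after its U-turn is a standard fenced arm of the half-turned
configuration** at the scales `(8 ⌊r/64⌋, N)`. [cite: Nolin2008, §4.2 (relocation of landing sequences), §4.3 Prop. 12 (i) (arXiv 0711.4948: Def. 8, Prop. 11)] -/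
theorem frameConfig_three_mem_sepOpenArm_of_uTurnA {r N : ℕ} (hr : 4096 ≤ r) (hrN : 2 * r ≤ N) {ω : SiteConfig (Site 2)}
    (hE : ω ∈ sepArmGen r N 3) (hT : ω ∈ uTurnA r) : frameConfig 3 ω ∈ sepOpenArm (8 * (r / 64)) N := by
  obtain ⟨z, zo, u, uo, hz, hzo, ⟨b, t, hb, ht, p₁, p₂⟩, hOut, P⟩ := hE
  obtain ⟨w, hFence, Pu⟩ := uTurnA_glue hr hz hb ht p₁ p₂ hT
  rw [← frameConfig_three_eq_rotConfig] at hFence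
  refine ⟨zo, _, w, uo, hzo, mk_mem_sepLanding _, hFence, hOut, ?_⟩
  set R : Set (Site 2) := uRegA r ∪ (triAnnulusSet r N ∪ frameIso 3 '' triOpenBall zo (N / 8) ∪ triOpenBall z (r / 8)) with hR
  have Pa : PathIn triGraph (R ∩ ω) (triRotIsoPow 3 w) u := Pu.symm.mono fun v hv => ⟨Or.inl hv.1, hv.2⟩
  have Pb : PathIn triGraph (R ∩ ω) u (frameIso 3 uo) := P.mono fun v hv => ⟨Or.inr hv.1, hv.2⟩
  have Pω := Pa.trans Pb
  have P3 := pathIn_rotConfig_three_of Pω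
  rw [rot3_rot3, show triRotIsoPow 3 ((frameIso 3 : triGraph ≃g triGraph) uo) = uo from by
    rw [rot3_eq_frameIso3]; exact frameIso_three_three uo, ← frameConfig_three_eq_rotConfig] at P3
  refine P3.mono ?_
  rintro _ ⟨⟨y, hy, rfl⟩, hχ⟩
  exact ⟨rot3_mem_sepJoinRegion hr hrN hz hy, hχ⟩

/-- The old join region (reflected into `κ`) of a landed arm of `sepArmGen r N 3` read in
`frameConfig 2 κ`, and the region of the closed U-turn, lie after the reflection `frameIso 5` in the
join region of the target arm. [folklore] -/
theorem frameIso5_mem_sepJoinRegion {r N : ℕ} (hr : 4096 ≤ r) (hrN : 2 * r ≤ N) {z zo : Site 2} (hz : z ∈ sepLanding r) {y : Site 2}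
    (hy : y ∈ uRegB r ∪ frameIso 2 '' (triAnnulusSet r N ∪ frameIso 3 '' triOpenBall zo (N / 8) ∪ triOpenBall z (r / 8))) :
    frameIso 5 y ∈ sepJoinRegion (8 * (r / 64)) N zo ![((8 * (r / 64) : ℕ) : ℤ), -((8 * (r / 64) / 2 : ℕ) : ℤ)] := by
  have hn : triNorm (frameIso 5 y) = triNorm y := triNorm_frameIso 5 (by norm_num) y
  have hrNz : 2 * (r : ℤ) ≤ N := by exact_mod_cast hrN
  have h8 : 8 * (r / 64) / 8 = r / 64 := by omega
  obtain ⟨q0, q1⟩ := frameIso5_apply y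
  rcases hy with hy | ⟨x, hx, rfl⟩
  · rcases hy with hy | hy
    · exact Or.inl (Or.inl (mem_triAnnulusSet.2 ⟨by rw [hn]; exact hy.1, by rw [hn]; have := hy.2; omega⟩))
    · refine Or.inr ?_
      rw [h8]
      rw [mem_triOpenBall, triNorm_lt_iff_lin] at hy ⊢
      obtain ⟨c0, c1⟩ := frameIso5_apply ![((8 * (r / 64) : ℕ) : ℤ), -((8 * (r / 64) / 2 : ℕ) : ℤ)]
      simp only [Pi.sub_apply, c0, c1, site_mk_apply_zero, site_mk_apply_one] at hy
      simp only [Pi.sub_apply, q0, q1, site_mk_apply_zero, site_mk_apply_one]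
      omega
  · have hn3 : triNorm (frameIso 3 x) = triNorm x := triNorm_frameIso 3 (by norm_num) x
    rw [show frameIso 5 ((frameIso 2 : triGraph ≃g triGraph) x) = frameIso 3 x from frameIso_five_two x]
    rcases hx with (hx | ⟨x', hx', rfl⟩) | hx
    · rw [mem_triAnnulusSet] at hx
      exact Or.inl (Or.inl (mem_triAnnulusSet.2 ⟨by rw [hn3]; have := hx.1; omega, by rw [hn3]; exact hx.2⟩))
    · rw [show frameIso 3 ((frameIso 3 : triGraph ≃g triGraph) x') = x' from frameIso_three_three x']
      exact Or.inl (Or.inr hx')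
    · have hzL := hz; rw [mem_sepLanding] at hzL
      rw [mem_triOpenBall, triNorm_lt_iff_lin] at hx
      simp only [Pi.sub_apply] at hx
      obtain ⟨-, -, -, -, -, -, f30, f31, -⟩ := frameIso_apply_formula x
      refine Or.inl (Or.inl (mem_triAnnulusSet.2 ⟨?_, ?_⟩))
      · exact le_triNorm_iff_lin.2 (Or.inr (Or.inl (by rw [f30]; omega)))
      · exact triNorm_le_iff_lin.2 (by rw [f30, f31]; omega)

/-- **The closed arm of `sepFourArmG r N 3` after its U-turn is a standard fenced arm read through the
frame `5`** at the scales `(8 ⌊r/64⌋, N)` (`κ` the colour-exchanged configuration). [cite: Nolin2008, §4.2 (relocation of landing sequences), §4.3 Prop. 12 (i) (arXiv 0711.4948: Def. 8, Prop. 11)] -/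
theorem frameConfig_five_mem_sepOpenArm_of_uTurnB {r N : ℕ} (hr : 4096 ≤ r) (hrN : 2 * r ≤ N) {κ : SiteConfig (Site 2)}
    (hE : frameConfig 2 κ ∈ sepArmGen r N 3) (hT : κ ∈ uTurnB r) : frameConfig 5 κ ∈ sepOpenArm (8 * (r / 64)) N := by
  obtain ⟨z, zo, u, uo, hz, hzo, ⟨b, t, hb, ht, p₁, p₂⟩, hOut, P⟩ := hE
  rw [frameConfig_three_two] at hOut
  obtain ⟨w, hFence, Pu⟩ := uTurnB_glue hr hz hb ht p₁ p₂ hT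
  refine ⟨zo, _, w, uo, hzo, mk_mem_sepLanding _, hFence, hOut, ?_⟩
  have P₂ := pathIn_of_frameConfig_two P
  set R : Set (Site 2) := uRegB r ∪ frameIso 2 '' (triAnnulusSet r N ∪ frameIso 3 '' triOpenBall zo (N / 8) ∪ triOpenBall z (r / 8)) with hR
  have Pa : PathIn triGraph (R ∩ κ) (frameIso 5 w) (frameIso 2 u) := Pu.symm.mono fun v hv => ⟨Or.inl hv.1, hv.2⟩
  have Pb : PathIn triGraph (R ∩ κ) (frameIso 2 u) (frameIso 2 (frameIso 3 uo)) := P₂.mono fun v hv => ⟨Or.inr hv.1, hv.2⟩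
  have Pκ := Pa.trans Pb
  have P5 := pathIn_frameConfig_five_of Pκ
  rw [frameIso_five_five, show frameIso 5 ((frameIso 2 : triGraph ≃g triGraph) ((frameIso 3 : triGraph ≃g triGraph) uo)) = uo from by
    rw [frameIso_two_three]; exact frameIso_five_five uo] at P5
  refine P5.mono ?_
  rintro _ ⟨⟨y, hy, rfl⟩, hχ⟩
  exact ⟨frameIso5_mem_sepJoinRegion hr hrN hz hy, hχ⟩

/-! ### The envelopes of the two colours and their disjointness (the lockstep nesting) -/

/-- **Envelope of the open arm at the side `0` and of its U-turn** (coordinates `x, y` of a site inside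
`Λ_r`): the sector wedge below the free space, the comb-and-highway box, the boxes of the U, the
connector and the half turn of the new free space. [folklore] -/
def uEnvA (r : ℕ) (x y : ℤ) : Prop :=
  ((r : ℤ) - (r / 8 : ℕ) ≤ x ∧ x ≤ (r : ℤ) - 1 ∧ y < 0 ∧ 0 < x + y) ∨
  ((r : ℤ) - (r / 8 : ℕ) - (r / 16 : ℕ) - 2 ≤ x ∧ x ≤ (r : ℤ) - 1 ∧ -(sepGlueHeight r : ℤ) ≤ y ∧ y ≤ 4 * (r / 64 : ℕ)) ∨
  (30 * ((r / 64 : ℕ) : ℤ) ≤ x ∧ x ≤ (r : ℤ) - (r / 8 : ℕ) - 2 ∧ 2 * ((r / 64 : ℕ) : ℤ) ≤ y ∧ y ≤ 4 * (r / 64 : ℕ)) ∨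
  (30 * ((r / 64 : ℕ) : ℤ) ≤ x ∧ x ≤ 32 * (r / 64 : ℕ) ∧ 2 * ((r / 64 : ℕ) : ℤ) ≤ y ∧ y ≤ 14 * (r / 64 : ℕ)) ∨
  (10 * ((r / 64 : ℕ) : ℤ) ≤ x ∧ x ≤ 32 * (r / 64 : ℕ) ∧ 12 * ((r / 64 : ℕ) : ℤ) ≤ y ∧ y ≤ 14 * (r / 64 : ℕ)) ∨
  (10 * ((r / 64 : ℕ) : ℤ) ≤ x ∧ x ≤ 12 * (r / 64 : ℕ) ∧ 12 * ((r / 64 : ℕ) : ℤ) ≤ y ∧ y ≤ 26 * (r / 64 : ℕ)) ∨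
  (-(6 * ((r / 64 : ℕ) : ℤ)) ≤ x ∧ x ≤ 12 * (r / 64 : ℕ) ∧ 24 * ((r / 64 : ℕ) : ℤ) ≤ y ∧ y ≤ 26 * (r / 64 : ℕ)) ∨
  (-(6 * ((r / 64 : ℕ) : ℤ)) ≤ x ∧ x ≤ -(4 * ((r / 64 : ℕ) : ℤ)) ∧ 13 * ((r / 64 : ℕ) : ℤ) ≤ y ∧ y ≤ 26 * (r / 64 : ℕ)) ∨
  (-(13 * ((r / 64 : ℕ) : ℤ)) ≤ x ∧ x ≤ -(4 * ((r / 64 : ℕ) : ℤ)) ∧ 13 * ((r / 64 : ℕ) : ℤ) ≤ y ∧ y ≤ 15 * (r / 64 : ℕ)) ∨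
  (-(13 * ((r / 64 : ℕ) : ℤ)) ≤ x ∧ x ≤ -(11 * ((r / 64 : ℕ) : ℤ)) ∧ 3 * ((r / 64 : ℕ) : ℤ) ≤ y ∧ y ≤ 15 * (r / 64 : ℕ)) ∨
  (-(13 * ((r / 64 : ℕ) : ℤ)) ≤ x ∧ x ≤ -(7 * ((r / 64 : ℕ) : ℤ)) - 1 ∧ 4 * ((r / 64 : ℕ) : ℤ) - (8 * (r / 64) / 64 : ℕ) ≤ y ∧ y ≤ 4 * (r / 64 : ℕ)) ∨
  (-(8 * ((r / 64 : ℕ) : ℤ)) + 1 ≤ x ∧ x ≤ -(7 * ((r / 64 : ℕ) : ℤ)) - 1 ∧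
    4 * ((r / 64 : ℕ) : ℤ) - (8 * (r / 64) / 64 : ℕ) ≤ y ∧ y ≤ 4 * ((r / 64 : ℕ) : ℤ) + (8 * (r / 64) / 64 : ℕ))

/-- **Envelope of the closed arm at the side `2` and of its U-turn** (in the coordinates of the
colour-exchanged configuration): the reflected sector wedge, the comb-and-highway box, the boxes of
the U, the connector and the reflection of the new free space. [folklore] -/
def uEnvB (r : ℕ) (x y : ℤ) : Prop :=
  ((r : ℤ) - (r / 8 : ℕ) ≤ y ∧ y ≤ (r : ℤ) - 1 ∧ x < 0 ∧ 0 < x + y) ∨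
  (-(55 * ((r / 64 : ℕ) : ℤ)) ≤ x ∧ x ≤ 0 ∧ (r : ℤ) - (r / 8 : ℕ) - (r / 16 : ℕ) - 2 ≤ y ∧ y ≤ (r : ℤ) - 1) ∨
  (-(50 * ((r / 64 : ℕ) : ℤ)) ≤ x ∧ x ≤ -(48 * ((r / 64 : ℕ) : ℤ)) ∧ 30 * ((r / 64 : ℕ) : ℤ) ≤ y ∧ y ≤ (r : ℤ) - (r / 8 : ℕ) - 2) ∨
  (-(50 * ((r / 64 : ℕ) : ℤ)) ≤ x ∧ x ≤ -(34 * ((r / 64 : ℕ) : ℤ)) ∧ 30 * ((r / 64 : ℕ) : ℤ) ≤ y ∧ y ≤ 32 * (r / 64 : ℕ)) ∨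
  (-(36 * ((r / 64 : ℕ) : ℤ)) ≤ x ∧ x ≤ -(34 * ((r / 64 : ℕ) : ℤ)) ∧ 10 * ((r / 64 : ℕ) : ℤ) ≤ y ∧ y ≤ 32 * (r / 64 : ℕ)) ∨
  (-(36 * ((r / 64 : ℕ) : ℤ)) ≤ x ∧ x ≤ -(20 * ((r / 64 : ℕ) : ℤ)) ∧ 10 * ((r / 64 : ℕ) : ℤ) ≤ y ∧ y ≤ 12 * (r / 64 : ℕ)) ∨
  (-(22 * ((r / 64 : ℕ) : ℤ)) ≤ x ∧ x ≤ -(20 * ((r / 64 : ℕ) : ℤ)) ∧ -(4 * ((r / 64 : ℕ) : ℤ)) ≤ y ∧ y ≤ 12 * (r / 64 : ℕ)) ∨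
  (-(22 * ((r / 64 : ℕ) : ℤ)) ≤ x ∧ x ≤ -(7 * ((r / 64 : ℕ) : ℤ)) ∧ -(4 * ((r / 64 : ℕ) : ℤ)) ≤ y ∧ y ≤ -(2 * ((r / 64 : ℕ) : ℤ))) ∨
  (-(9 * ((r / 64 : ℕ) : ℤ)) ≤ x ∧ x ≤ -(7 * ((r / 64 : ℕ) : ℤ)) ∧ -(11 * ((r / 64 : ℕ) : ℤ)) ≤ y ∧ y ≤ -(2 * ((r / 64 : ℕ) : ℤ))) ∨
  (-(9 * ((r / 64 : ℕ) : ℤ)) ≤ x ∧ x ≤ 4 * (r / 64 : ℕ) ∧ -(11 * ((r / 64 : ℕ) : ℤ)) ≤ y ∧ y ≤ -(9 * ((r / 64 : ℕ) : ℤ))) ∨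
  (4 * ((r / 64 : ℕ) : ℤ) - (8 * (r / 64) / 64 : ℕ) ≤ x ∧ x ≤ 4 * (r / 64 : ℕ) ∧ -(11 * ((r / 64 : ℕ) : ℤ)) ≤ y ∧ y ≤ -(7 * ((r / 64 : ℕ) : ℤ)) - 1) ∨
  (4 * ((r / 64 : ℕ) : ℤ) - (8 * (r / 64) / 64 : ℕ) ≤ x ∧ x ≤ 4 * ((r / 64 : ℕ) : ℤ) + (8 * (r / 64) / 64 : ℕ) ∧
    -(8 * ((r / 64 : ℕ) : ℤ)) + 1 ≤ y ∧ y ≤ -(7 * ((r / 64 : ℕ) : ℤ)) - 1)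

/-- Arithmetic of the envelopes. [folklore] -/
private theorem masterEnv {r : ℕ} (hr : 4096 ≤ r) :
    (sepGlueHeight r : ℤ) = r - (r / 4 : ℕ) + (r / 64 : ℕ) ∧ (64 : ℤ) ≤ (r / 64 : ℕ) ∧
    1 ≤ ((8 * (r / 64) / 64 : ℕ) : ℤ) ∧ 8 * ((8 * (r / 64) / 64 : ℕ) : ℤ) ≤ (r / 64 : ℕ) := by
  refine ⟨sepGlueHeight_cast r, by omega, by omega, by omega⟩

set_option maxHeartbeats 1600000 in
/-- **The two envelopes are disjoint** (radial and angular bookkeeping of the lockstep nesting). [folklore] -/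
theorem uEnv_disjoint {r : ℕ} (hr : 4096 ≤ r) {x y : ℤ} (hA : uEnvA r x y) (hB : uEnvB r x y) : False := by
  obtain ⟨hG, k64, kt1, kt8⟩ := masterEnv hr
  have F8 := flz r 8 (by norm_num); have F16 := flz r 16 (by norm_num); have F4 := flz r 4 (by norm_num)
  have F64 := flz r 64 (by norm_num)
  simp only [Nat.cast_ofNat] at F8 F16 F4 F64
  unfold uEnvA at hA; unfold uEnvB at hB
  generalize r / 8 = q8 at *
  generalize r / 16 = q16 at *
  generalize r / 4 = q4 at *
  generalize r / 64 = q64 at *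
  generalize 8 * q64 / 64 = tt at *
  rcases hA with hA | hA | hA | hA | hA | hA | hA | hA | hA | hA | hA | hA <;>
    rcases hB with hB | hB | hB | hB | hB | hB | hB | hB | hB | hB | hB | hB <;> omega

set_option maxHeartbeats 1600000 in
/-- **The envelope of the open arm at the side `0` is disjoint from the half turn of the envelope of the
closed arm at the side `2`** (the closed arm at the side `5`). [folklore] -/
theorem uEnv_disjoint_neg {r : ℕ} (hr : 4096 ≤ r) {x y : ℤ} (hA : uEnvA r x y) (hB : uEnvB r (-x) (-y)) : False := by
  obtain ⟨hG, k64, kt1, kt8⟩ := masterEnv hr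
  have F8 := flz r 8 (by norm_num); have F16 := flz r 16 (by norm_num); have F4 := flz r 4 (by norm_num)
  have F64 := flz r 64 (by norm_num)
  simp only [Nat.cast_ofNat] at F8 F16 F4 F64
  unfold uEnvA at hA; unfold uEnvB at hB
  generalize r / 8 = q8 at *
  generalize r / 16 = q16 at *
  generalize r / 4 = q4 at *
  generalize r / 64 = q64 at *
  generalize 8 * q64 / 64 = tt at *
  rcases hA with hA | hA | hA | hA | hA | hA | hA | hA | hA | hA | hA | hA <;>
    rcases hB with hB | hB | hB | hB | hB | hB | hB | hB | hB | hB | hB | hB <;> omega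

/-! ### The supports of the corridors lie in the envelopes -/

/-- Arithmetic helper. [folklore] -/
private theorem castE1 {r : ℕ} (hr : 4096 ≤ r) :
    ((r - r / 8 - 2 - 30 * (r / 64) : ℕ) : ℤ) = (r : ℤ) - (r / 8 : ℕ) - 2 - 30 * (r / 64 : ℕ) := by omega
/-- Arithmetic helper. [folklore] -/
private theorem castE2 {r : ℕ} (hr : 4096 ≤ r) : ((6 * (r / 64) - 1 : ℕ) : ℤ) = 6 * (r / 64 : ℕ) - 1 := by omega
/-- Arithmetic helper. [folklore] -/
private theorem castE4 {r : ℕ} (hr : 4096 ≤ r) : ((8 * (r / 64) / 8 - 2 : ℕ) : ℤ) = (r / 64 : ℕ) - 2 := by omega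
/-- Arithmetic helper. [folklore] -/
private theorem castE5 {r : ℕ} (hr : 4096 ≤ r) : ((4 * (r / 64) - 1 : ℕ) : ℤ) = 4 * (r / 64 : ℕ) - 1 := by omega
/-- Arithmetic helper. [folklore] -/
private theorem masterSup {r i : ℕ} (hr : 4096 ≤ r) (hi : i < 90) :
    -(sepGlueHeight r : ℤ) + i * ((r / 64 / 2 : ℕ) : ℤ) + (r / 64 / 2 : ℕ) ≤ 0 ∧
    ((8 * (r / 64) : ℕ) : ℤ) = 8 * (r / 64 : ℕ) ∧ ((8 * (r / 64) / 2 : ℕ) : ℤ) = 4 * (r / 64 : ℕ) ∧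
    (r : ℤ) - (r / 8 : ℕ) - 2 + 4 * (r / 64 : ℕ) ≤ (r : ℤ) - 1 ∧ (sepGlueHeight r : ℤ) < (r : ℤ) - (r / 8 : ℕ) - (r / 16 : ℕ) - 2 ∧
    (64 : ℤ) ≤ (r / 64 : ℕ) ∧ 1 ≤ ((8 * (r / 64) / 64 : ℕ) : ℤ) ∧ 8 * ((8 * (r / 64) / 64 : ℕ) : ℤ) ≤ (r / 64 : ℕ) := by
  have hH := sepGlueHeight_cast r
  have hi' : (i : ℤ) * ((r / 64 / 2 : ℕ) : ℤ) ≤ 89 * ((r / 64 / 2 : ℕ) : ℤ) :=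
    mul_le_mul_of_nonneg_right (by exact_mod_cast Nat.le_of_lt_succ hi) (by positivity)
  refine ⟨by omega, by omega, by omega, by omega, by omega, by omega, by omega, by omega⟩

set_option maxHeartbeats 800000 in
/-- **The open U-turn lies in its envelope, inside `Λ_{r-1}`.** [folklore] -/
theorem uTurnAFinset_subset {r : ℕ} (hr : 4096 ≤ r) {v : Site 2} (hv : v ∈ uTurnAFinset r) :
    triNorm v ≤ (r : ℤ) - 1 ∧ uEnvA r (v 0) (v 1) := by
  obtain ⟨-, e8, e4, kA, kS, k64, kt1, kt8⟩ := masterSup (i := 0) hr (by norm_num)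
  have kG0 : (0 : ℤ) ≤ sepGlueHeight r := by positivity
  simp only [uTurnAFinset, Finset.mem_union, Finset.mem_biUnion, Finset.mem_range] at hv
  rcases hv with (hv | ⟨k, hk, hv⟩) | ⟨i, hi, hv⟩
  · rw [uFenceAF, Finset.mem_image] at hv
    obtain ⟨u, hu, rfl⟩ := hv
    rw [← Finset.mem_coe, coe_triStripFinset, mem_triStrip, castE4 hr, e8, e4] at hu
    obtain ⟨r0, r1⟩ := rot3_apply u
    simp only [Nat.cast_mul, Nat.cast_ofNat] at hu
    refine ⟨triNorm_le_iff_lin.2 ?_, ?_⟩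
    · rw [r0, r1]; omega
    · rw [r0, r1]; exact Or.inr (Or.inr (Or.inr (Or.inr (Or.inr (Or.inr (Or.inr (Or.inr (Or.inr (Or.inr (Or.inr (⟨by omega, by omega, by omega, by omega⟩)))))))))))
  · interval_cases k <;> rw [uBoxAF, ← Finset.mem_coe, coe_triStripFinset, mem_triStrip] at hv
    · simp only [Nat.cast_add, Nat.cast_mul, Nat.cast_ofNat] at hv
      exact ⟨triNorm_le_iff_lin.2 (by omega), Or.inr (Or.inl ⟨by omega, by omega, by omega, by omega⟩)⟩
    · rw [castE1 hr] at hv; simp only [Nat.cast_mul, Nat.cast_ofNat] at hv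
      exact ⟨triNorm_le_iff_lin.2 (by omega), Or.inr (Or.inr (Or.inl ⟨by omega, by omega, by omega, by omega⟩))⟩
    · simp only [Nat.cast_mul, Nat.cast_ofNat] at hv
      exact ⟨triNorm_le_iff_lin.2 (by omega), Or.inr (Or.inr (Or.inr (Or.inl ⟨by omega, by omega, by omega, by omega⟩)))⟩
    · simp only [Nat.cast_mul, Nat.cast_ofNat] at hv
      exact ⟨triNorm_le_iff_lin.2 (by omega), Or.inr (Or.inr (Or.inr (Or.inr (Or.inl ⟨by omega, by omega, by omega, by omega⟩))))⟩
    · simp only [Nat.cast_mul, Nat.cast_ofNat] at hv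
      exact ⟨triNorm_le_iff_lin.2 (by omega), Or.inr (Or.inr (Or.inr (Or.inr (Or.inr (Or.inl ⟨by omega, by omega, by omega, by omega⟩)))))⟩
    · simp only [Nat.cast_mul, Nat.cast_ofNat] at hv
      exact ⟨triNorm_le_iff_lin.2 (by omega), Or.inr (Or.inr (Or.inr (Or.inr (Or.inr (Or.inr (Or.inl ⟨by omega, by omega, by omega, by omega⟩))))))⟩
    · simp only [Nat.cast_mul, Nat.cast_ofNat] at hv
      exact ⟨triNorm_le_iff_lin.2 (by omega), Or.inr (Or.inr (Or.inr (Or.inr (Or.inr (Or.inr (Or.inr (Or.inl ⟨by omega, by omega, by omega, by omega⟩)))))))⟩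
    · simp only [Nat.cast_mul, Nat.cast_ofNat] at hv
      exact ⟨triNorm_le_iff_lin.2 (by omega), Or.inr (Or.inr (Or.inr (Or.inr (Or.inr (Or.inr (Or.inr (Or.inr (Or.inl ⟨by omega, by omega, by omega, by omega⟩))))))))⟩
    · simp only [Nat.cast_mul, Nat.cast_ofNat] at hv
      exact ⟨triNorm_le_iff_lin.2 (by omega), Or.inr (Or.inr (Or.inr (Or.inr (Or.inr (Or.inr (Or.inr (Or.inr (Or.inr (Or.inl ⟨by omega, by omega, by omega, by omega⟩)))))))))⟩
    · rw [castE2 hr] at hv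
      exact ⟨triNorm_le_iff_lin.2 (by omega), Or.inr (Or.inr (Or.inr (Or.inr (Or.inr (Or.inr (Or.inr (Or.inr (Or.inr (Or.inr (Or.inl ⟨by omega, by omega, by omega, by omega⟩))))))))))⟩
  · rw [uCombAF, ← Finset.mem_coe, coe_triStripFinset, mem_triStrip] at hv
    simp only [Nat.cast_add, Nat.cast_one] at hv
    obtain ⟨kG, -⟩ := masterSup (i := i) hr hi
    have hih : (0 : ℤ) ≤ (i : ℤ) * ((r / 64 / 2 : ℕ) : ℤ) := by positivity
    exact ⟨triNorm_le_iff_lin.2 (by omega), Or.inr (Or.inl ⟨by omega, by omega, by omega, by omega⟩)⟩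

set_option maxHeartbeats 800000 in
/-- **The closed U-turn lies in its envelope, inside `Λ_{r-1}`.** [folklore] -/
theorem uTurnBFinset_subset {r : ℕ} (hr : 4096 ≤ r) {v : Site 2} (hv : v ∈ uTurnBFinset r) :
    triNorm v ≤ (r : ℤ) - 1 ∧ uEnvB r (v 0) (v 1) := by
  obtain ⟨-, e8, e4, kA, kS, k64, kt1, kt8⟩ := masterSup (i := 0) hr (by norm_num)
  have kG0 : (0 : ℤ) ≤ sepGlueHeight r := by positivity
  have hH := sepGlueHeight_cast r
  simp only [uTurnBFinset, Finset.mem_union, Finset.mem_biUnion, Finset.mem_range] at hv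
  rcases hv with (hv | ⟨k, hk, hv⟩) | ⟨i, hi, hv⟩
  · rw [uFenceBF, Finset.mem_image] at hv
    obtain ⟨u, hu, rfl⟩ := hv
    rw [← Finset.mem_coe, coe_triStripFinset, mem_triStrip, castE4 hr, e8, e4] at hu
    obtain ⟨r0, r1⟩ := frameIso5_apply u
    simp only [Nat.cast_mul, Nat.cast_ofNat] at hu
    refine ⟨triNorm_le_iff_lin.2 ?_, ?_⟩
    · rw [r0, r1]; omega
    · rw [r0, r1]; exact Or.inr (Or.inr (Or.inr (Or.inr (Or.inr (Or.inr (Or.inr (Or.inr (Or.inr (Or.inr (Or.inr (⟨by omega, by omega, by omega, by omega⟩)))))))))))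
  · interval_cases k <;> rw [uBoxBF, ← Finset.mem_coe, coe_triStripFinset, mem_triStrip] at hv
    · simp only [Nat.cast_mul, Nat.cast_ofNat] at hv
      exact ⟨triNorm_le_iff_lin.2 (by omega), Or.inr (Or.inl ⟨by omega, by omega, by omega, by omega⟩)⟩
    · rw [castE1 hr] at hv; simp only [Nat.cast_mul, Nat.cast_ofNat] at hv
      exact ⟨triNorm_le_iff_lin.2 (by omega), Or.inr (Or.inr (Or.inl ⟨by omega, by omega, by omega, by omega⟩))⟩
    · simp only [Nat.cast_mul, Nat.cast_ofNat] at hv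
      exact ⟨triNorm_le_iff_lin.2 (by omega), Or.inr (Or.inr (Or.inr (Or.inl ⟨by omega, by omega, by omega, by omega⟩)))⟩
    · simp only [Nat.cast_mul, Nat.cast_ofNat] at hv
      exact ⟨triNorm_le_iff_lin.2 (by omega), Or.inr (Or.inr (Or.inr (Or.inr (Or.inl ⟨by omega, by omega, by omega, by omega⟩))))⟩
    · simp only [Nat.cast_mul, Nat.cast_ofNat] at hv
      exact ⟨triNorm_le_iff_lin.2 (by omega), Or.inr (Or.inr (Or.inr (Or.inr (Or.inr (Or.inl ⟨by omega, by omega, by omega, by omega⟩)))))⟩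
    · simp only [Nat.cast_mul, Nat.cast_ofNat] at hv
      exact ⟨triNorm_le_iff_lin.2 (by omega), Or.inr (Or.inr (Or.inr (Or.inr (Or.inr (Or.inr (Or.inl ⟨by omega, by omega, by omega, by omega⟩))))))⟩
    · simp only [Nat.cast_mul, Nat.cast_ofNat] at hv
      exact ⟨triNorm_le_iff_lin.2 (by omega), Or.inr (Or.inr (Or.inr (Or.inr (Or.inr (Or.inr (Or.inr (Or.inl ⟨by omega, by omega, by omega, by omega⟩)))))))⟩
    · simp only [Nat.cast_mul, Nat.cast_ofNat] at hv
      exact ⟨triNorm_le_iff_lin.2 (by omega), Or.inr (Or.inr (Or.inr (Or.inr (Or.inr (Or.inr (Or.inr (Or.inr (Or.inl ⟨by omega, by omega, by omega, by omega⟩))))))))⟩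
    · simp only [Nat.cast_mul, Nat.cast_ofNat] at hv
      exact ⟨triNorm_le_iff_lin.2 (by omega), Or.inr (Or.inr (Or.inr (Or.inr (Or.inr (Or.inr (Or.inr (Or.inr (Or.inr (Or.inl ⟨by omega, by omega, by omega, by omega⟩)))))))))⟩
    · rw [castE5 hr] at hv
      exact ⟨triNorm_le_iff_lin.2 (by omega), Or.inr (Or.inr (Or.inr (Or.inr (Or.inr (Or.inr (Or.inr (Or.inr (Or.inr (Or.inr (Or.inl ⟨by omega, by omega, by omega, by omega⟩))))))))))⟩
  · rw [inCombBF, ← Finset.mem_coe, coe_triStripFinset, mem_triStrip] at hv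
    simp only [Nat.cast_add, Nat.cast_one] at hv
    obtain ⟨kG, -⟩ := masterSup (i := i) hr hi
    have hih : (0 : ℤ) ≤ (i : ℤ) * ((r / 64 / 2 : ℕ) : ℤ) := by positivity
    exact ⟨triNorm_le_iff_lin.2 (by omega), Or.inr (Or.inl ⟨by omega, by omega, by omega, by omega⟩)⟩

/-- **The inner sector wedge of the arm support lies in the envelope of the open arm.** [folklore] -/
theorem uEnvA_of_armCone {r N : ℕ} {v : Site 2} (hv : v ∈ armConeSet r N) (hlt : triNorm v < r) :
    triNorm v ≤ (r : ℤ) - 1 ∧ uEnvA r (v 0) (v 1) := by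
  rw [mem_armConeSet] at hv
  obtain ⟨h1, -, h3⟩ := hv
  obtain ⟨c1, c2⟩ := h3 hlt
  have hle := triNorm_le_iff_lin.1 (show triNorm v ≤ (r : ℤ) - 1 by omega)
  have hlo := le_triNorm_iff_lin.1 h1
  refine ⟨by omega, Or.inl ⟨?_, by omega, c1, c2⟩⟩
  rcases hlo with h | h | h | h | h | h <;> omega

/-- **The inner sector wedge of the arm support, reflected, lies in the envelope of the closed arm.** [folklore] -/
theorem uEnvB_of_armCone {r N : ℕ} {v : Site 2} (hv : v ∈ armConeSet r N) (hlt : triNorm v < r) :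
    triNorm v ≤ (r : ℤ) - 1 ∧ uEnvB r (v 1) (v 0) := by
  rw [mem_armConeSet] at hv
  obtain ⟨h1, -, h3⟩ := hv
  obtain ⟨c1, c2⟩ := h3 hlt
  have hle := triNorm_le_iff_lin.1 (show triNorm v ≤ (r : ℤ) - 1 by omega)
  have hlo := le_triNorm_iff_lin.1 h1
  refine ⟨by omega, Or.inl ⟨?_, by omega, c1, by omega⟩⟩
  rcases hlo with h | h | h | h | h | h <;> omega

/-! ### The untwisting at constant cost -/

set_option maxHeartbeats 1600000 in
/-- **Untwisting the half-turned landing at constant cost, at `p`** (Nolin 2008, §4.2 relocation of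
the landing sequences via §4.3 Lemma 13): with the RSW input `hrsw` at `p` and at `1 - p` (aspect
ratio `ρ ≥ 64`, heights `≤ Ncap`), for `4096 ≤ r`, `2r ≤ N`, `r ≤ Ncap`:
`P_p(sepFourArmG r N 3) · ((c^101)²)² ≤ P_p(sepFourArmQ (8 ⌊r/64⌋) N)`. The generalised FKG inequality
`triSitePercolation_locallyMonotone_fkg` with the shared shell `{r ≤ |v| ≤ N + N/8}`, the increasing
region (inside `Λ_r`: the envelope `uEnvA` of the open arm at the side `0` with its U-turn, and its
half turn) and the decreasing region (the envelope `uEnvB` of the closed arm at the side `2` with its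
U-turn, and its half turn) — disjoint by `uEnv_disjoint`, `uEnv_disjoint_neg` —, Harris at `p` and at
`1 - p` for the two pairs of corridors, and the deterministic U-turns
(`frameConfig_three_mem_sepOpenArm_of_uTurnA`, `frameConfig_five_mem_sepOpenArm_of_uTurnB`). [cite: Nolin2008, §4.2, §4.3 Prop. 12 (i) and Lemma 13 (arXiv 0711.4948: Def. 8, Prop. 11, Lemma 12); §4.4 p. 13] -/
theorem real_sepFourArmG_three_mul_le_sepFourArmQ_at (p : unitInterval) {c : ℝ} {ρ Ncap : ℕ}
    (hrsw : ∀ q : unitInterval, (q = p ∨ q = unitInterval.symm p) →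
      ∀ k : ℕ, 1 ≤ ⌊(ρ : ℝ) * k⌋₊ → k ≤ Ncap → c ≤ triLRCrossingProb q ⌊(ρ : ℝ) * k⌋₊ k)
    (hρ : 64 ≤ ρ) (hc : 0 ≤ c) {r N : ℕ} (hr : 4096 ≤ r) (hrN : 2 * r ≤ N) (hcap : r ≤ Ncap) :
    (triSitePercolation p).real (sepFourArmG r N 3) * ((c ^ 101) ^ 2) ^ 2 ≤
      (triSitePercolation p).real (sepFourArmQ (8 * (r / 64)) N) := by
  classical
  -- the three pairwise disjoint regions of Nolin's Lemma 13
  set S : Finset (Site 2) := (triBall (N + N / 8)).filter (fun v => (r : ℤ) ≤ triNorm v) with hS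
  set P : Finset (Site 2) := (triBall (r - 1)).filter (fun v => uEnvA r (v 0) (v 1) ∨ uEnvA r (-v 0) (-v 1)) with hP
  set M : Finset (Site 2) := (triBall (r - 1)).filter (fun v => uEnvB r (v 0) (v 1) ∨ uEnvB r (-v 0) (-v 1)) with hM
  have hr1 : ((r - 1 : ℕ) : ℤ) = (r : ℤ) - 1 := by omega
  have hSP : Disjoint S P := by
    rw [Finset.disjoint_left]; intro v hvS hvP
    simp only [hS, hP, Finset.mem_filter, mem_triBall_iff, hr1] at hvS hvP
    omega
  have hSM : Disjoint S M := by
    rw [Finset.disjoint_left]; intro v hvS hvM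
    simp only [hS, hM, Finset.mem_filter, mem_triBall_iff, hr1] at hvS hvM
    omega
  have hPM : Disjoint P M := by
    rw [Finset.disjoint_left]; intro v hvP hvM
    simp only [hP, hM, Finset.mem_filter] at hvP hvM
    rcases hvP.2 with hA | hA <;> rcases hvM.2 with hB | hB
    · exact uEnv_disjoint hr hA hB
    · exact uEnv_disjoint_neg hr hA hB
    · exact uEnv_disjoint_neg hr (x := -v 0) (y := -v 1) hA (by rw [neg_neg, neg_neg]; exact hB)
    · exact uEnv_disjoint hr hA hB
  have hrNz : 2 * (r : ℤ) ≤ N := by exact_mod_cast hrN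
  -- supports of the arms
  have coneSup : ∀ (i : ℕ) (hi : i < 6), (i = 0 ∨ i = 3 → frameIso i '' armConeSet r N ⊆ ↑S ∪ ↑P) ∧
      (i = 2 ∨ i = 5 → frameIso i '' armConeSet r N ⊆ ↑S ∪ ↑M) := by
    intro i hi
    constructor
    · rintro hi0 v ⟨u, hu, rfl⟩
      simp only [hS, hP, Set.mem_union, Finset.mem_coe, Finset.mem_filter, mem_triBall_iff, triNorm_frameIso i hi, hr1]
      by_cases h : (r : ℤ) ≤ triNorm u
      · left; rw [mem_armConeSet] at hu; exact ⟨hu.2.1, h⟩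
      · right
        obtain ⟨hn, hE⟩ := uEnvA_of_armCone hu (by omega)
        obtain ⟨f00, f01, -, -, -, -, f30, f31, -⟩ := frameIso_apply_formula u
        refine ⟨hn, ?_⟩
        rcases hi0 with rfl | rfl
        · left; rw [f00, f01]; exact hE
        · right; rw [f30, f31, neg_neg, neg_neg]; exact hE
    · rintro hi2 v ⟨u, hu, rfl⟩
      simp only [hS, hM, Set.mem_union, Finset.mem_coe, Finset.mem_filter, mem_triBall_iff, triNorm_frameIso i hi, hr1]
      by_cases h : (r : ℤ) ≤ triNorm u
      · left; rw [mem_armConeSet] at hu; exact ⟨hu.2.1, h⟩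
      · right
        obtain ⟨hn, hE'⟩ := uEnvB_of_armCone hu (by omega)
        obtain ⟨-, -, -, -, f20, f21, -, -, -, -, f50, f51⟩ := frameIso_apply_formula u
        refine ⟨hn, ?_⟩
        rcases hi2 with rfl | rfl
        · left; rw [f20, f21]; exact hE'
        · right; rw [f50, f51, neg_neg, neg_neg]; exact hE'
  -- supports of the corridors
  have supA : (↑(uTurnAFinset r) : Set (Site 2)) ⊆ ↑P := fun v hv => by
    obtain ⟨hn, hE⟩ := uTurnAFinset_subset hr (Finset.mem_coe.1 hv)
    simp only [hP, Finset.mem_coe, Finset.mem_filter, mem_triBall_iff, hr1]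
    exact ⟨hn, Or.inl hE⟩
  have supA3 : triRotIsoPow 3 '' (↑(uTurnAFinset r) : Set (Site 2)) ⊆ ↑P := by
    rintro _ ⟨u, hu, rfl⟩
    obtain ⟨hn, hE⟩ := uTurnAFinset_subset hr (Finset.mem_coe.1 hu)
    obtain ⟨r0, r1⟩ := rot3_apply u
    simp only [hP, Finset.mem_coe, Finset.mem_filter, mem_triBall_iff, triNorm_rot 3 u, hr1]
    rw [show ((triRotIsoPow 3 : triGraph ≃g triGraph) u) = triRotIsoPow 3 u from rfl, r0, r1, neg_neg, neg_neg]
    exact ⟨hn, Or.inr hE⟩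
  have supB : (↑(uTurnBFinset r) : Set (Site 2)) ⊆ ↑M := fun v hv => by
    obtain ⟨hn, hE⟩ := uTurnBFinset_subset hr (Finset.mem_coe.1 hv)
    simp only [hM, Finset.mem_coe, Finset.mem_filter, mem_triBall_iff, hr1]
    exact ⟨hn, Or.inl hE⟩
  have supB3 : triRotIsoPow 3 '' (↑(uTurnBFinset r) : Set (Site 2)) ⊆ ↑M := by
    rintro _ ⟨u, hu, rfl⟩
    obtain ⟨hn, hE⟩ := uTurnBFinset_subset hr (Finset.mem_coe.1 hu)
    obtain ⟨r0, r1⟩ := rot3_apply u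
    simp only [hM, Finset.mem_coe, Finset.mem_filter, mem_triBall_iff, triNorm_rot 3 u, hr1]
    rw [show ((triRotIsoPow 3 : triGraph ≃g triGraph) u) = triRotIsoPow 3 u from rfl, r0, r1, neg_neg, neg_neg]
    exact ⟨hn, Or.inr hE⟩
  -- the events
  set E := sepArmGen r N 3 with hE
  set TA := uTurnA r with hTA
  set TB := uTurnB r with hTB
  set Ap : Set (SiteConfig (Site 2)) := E ∩ {ω | frameConfig 3 ω ∈ E} with hAp
  set Am : Set (SiteConfig (Site 2)) := {ω | frameConfig 2 ωᶜ ∈ E} ∩ {ω | frameConfig 5 ωᶜ ∈ E} with hAm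
  set Bp : Set (SiteConfig (Site 2)) := TA ∩ (rotConfig 3 ⁻¹' TA) with hBp
  set Bm : Set (SiteConfig (Site 2)) := {ω | ωᶜ ∈ TB} ∩ {ω | (rotConfig 3 ω)ᶜ ∈ TB} with hBm
  have huE : IsUpperSet E := isUpperSet_sepArmGen r N 3
  have huTA : IsUpperSet TA := isUpperSet_uTurnA r
  have huTB : IsUpperSet TB := isUpperSet_uTurnB r
  have upre : ∀ {F : Set (SiteConfig (Site 2))}, IsUpperSet F → ∀ i, IsUpperSet {ω : SiteConfig (Site 2) | frameConfig i ω ∈ F} :=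
    fun hF i ω ω' h hω => hF (frameConfig_mono i h) hω
  have lpre : ∀ {F : Set (SiteConfig (Site 2))}, IsUpperSet F → ∀ i, IsLowerSet {ω : SiteConfig (Site 2) | frameConfig i ωᶜ ∈ F} :=
    fun hF i ω ω' h hω => hF (frameConfig_mono i (Set.compl_subset_compl.2 h)) hω
  have hAp_up : IsUpperSet Ap := huE.inter (upre huE 3)
  have hAm_lo : IsLowerSet Am := (lpre huE 2).inter (lpre huE 5)
  have u3 : IsUpperSet (rotConfig 3 ⁻¹' TA) := fun ω ω' h hω => huTA (rotConfig_mono 3 h) hω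
  have hBp_up : IsUpperSet Bp := huTA.inter u3
  have hBm_lo : IsLowerSet Bm := by
    refine IsLowerSet.inter (fun ω ω' h hω => huTB (Set.compl_subset_compl.2 h) hω) (fun ω ω' h hω => huTB ?_ hω)
    exact Set.compl_subset_compl.2 (rotConfig_mono 3 h)
  -- locality of the arms
  have dE : DeterminedBy E (armConeSet r N) := determinedBy_sepArmGen_cone (by norm_num) (by omega) hrN
  have dEf := fun i => determinedBy_preimage_frameConfig i dE
  have dEfc : ∀ i, DeterminedBy {ω : SiteConfig (Site 2) | frameConfig i ωᶜ ∈ E} (frameIso i '' armConeSet r N) := fun i => by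
    have h2 : {ω : SiteConfig (Site 2) | frameConfig i ωᶜ ∈ E} =
        {ω : SiteConfig (Site 2) | ωᶜ ∈ {χ : SiteConfig (Site 2) | frameConfig i χ ∈ E}} := by
      ext ω; simp only [Set.mem_setOf_eq]
    rw [h2]; exact DeterminedBy.preimage_compl' (dEf i)
  have hE0 : {ω : SiteConfig (Site 2) | frameConfig 0 ω ∈ E} = E := by
    ext ω; simp only [Set.mem_setOf_eq, frameConfig_zero]
  have dAp : DeterminedBy Ap (↑S ∪ ↑P) := by
    refine DeterminedBy.inter ?_ ((dEf 3).mono ((coneSup 3 (by norm_num)).1 (Or.inr rfl)))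
    have := (dEf 0).mono ((coneSup 0 (by norm_num)).1 (Or.inl rfl))
    rwa [hE0] at this
  have dAm : DeterminedBy Am (↑S ∪ ↑M) :=
    ((dEfc 2).mono ((coneSup 2 (by norm_num)).2 (Or.inl rfl))).inter ((dEfc 5).mono ((coneSup 5 (by norm_num)).2 (Or.inr rfl)))
  -- locality of the corridors
  have dTA : DeterminedBy TA ↑(uTurnAFinset r) := determinedBy_uTurnA r
  have dTB : DeterminedBy TB ↑(uTurnBFinset r) := determinedBy_uTurnB r
  have dBp : DeterminedBy Bp ↑P := (dTA.mono supA).inter ((determinedBy_preimage_rotConfig 3 dTA).mono supA3)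
  have hBm2 : {ω : SiteConfig (Site 2) | (rotConfig 3 ω)ᶜ ∈ TB} = {ω : SiteConfig (Site 2) | ωᶜ ∈ rotConfig 3 ⁻¹' TB} := by
    ext ω; simp only [Set.mem_setOf_eq, Set.mem_preimage, rotConfig_compl]
  have dBm : DeterminedBy Bm ↑M := by
    refine DeterminedBy.inter ((DeterminedBy.preimage_compl' dTB).mono supB) ?_
    rw [hBm2]
    exact (DeterminedBy.preimage_compl' (determinedBy_preimage_rotConfig 3 dTB)).mono supB3
  have fkg := triSitePercolation_locallyMonotone_fkg p hSP hSM hPM hAp_up hAm_lo hBp_up hBm_lo dAp dAm dBp dBm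
  -- the corridor probabilities
  have hK : 0 ≤ c ^ 101 := pow_nonneg hc _
  have hBp_ge : (c ^ 101) ^ 2 ≤ (triSitePercolation p).real Bp := by
    have h1 := le_real_uTurnA_at p (hrsw p (Or.inl rfl)) hρ hc hr hcap
    have h3 : (triSitePercolation p).real (rotConfig 3 ⁻¹' TA) = (triSitePercolation p).real TA := real_preimage_rotConfig p 3 TA
    have d3' : DeterminedBy (rotConfig 3 ⁻¹' TA) ↑((uTurnAFinset r).image (triRotIsoPow 3)) := by
      rw [Finset.coe_image]; exact determinedBy_preimage_rotConfig 3 dTA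
    have har := sitePercolation_harris' p dTA d3' huTA u3
    unfold triSitePercolation at h1 h3 ⊢
    rw [h3] at har
    calc (c ^ 101) ^ 2 = c ^ 101 * c ^ 101 := sq _
      _ ≤ (sitePercolation (Site 2) p).real TA * (sitePercolation (Site 2) p).real TA := mul_le_mul h1 h1 hK measureReal_nonneg
      _ ≤ _ := har
  have hBm_ge : (c ^ 101) ^ 2 ≤ (triSitePercolation p).real Bm := by
    set q := unitInterval.symm p with hq
    have heq : Bm = compl ⁻¹' (TB ∩ rotConfig 3 ⁻¹' TB) := by
      ext ω
      simp only [hBm, Set.mem_inter_iff, Set.mem_setOf_eq, Set.mem_preimage, rotConfig_compl]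
    have hcmp := sitePercolation_real_preimage_compl p (TB ∩ rotConfig 3 ⁻¹' TB)
    have h1 := le_real_uTurnB_at q (hrsw q (Or.inr rfl)) hρ hc hr hcap
    have h3 : (triSitePercolation q).real (rotConfig 3 ⁻¹' TB) = (triSitePercolation q).real TB := real_preimage_rotConfig q 3 TB
    have d3' : DeterminedBy (rotConfig 3 ⁻¹' TB) ↑((uTurnBFinset r).image (triRotIsoPow 3)) := by
      rw [Finset.coe_image]; exact determinedBy_preimage_rotConfig 3 dTB
    have u3' : IsUpperSet (rotConfig 3 ⁻¹' TB) := fun ω ω' h hω => huTB (rotConfig_mono 3 h) hω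
    have har := sitePercolation_harris' q dTB d3' huTB u3'
    unfold triSitePercolation at h1 h3 hcmp ⊢
    rw [h3] at har
    rw [heq, hcmp]
    calc (c ^ 101) ^ 2 = c ^ 101 * c ^ 101 := sq _
      _ ≤ (sitePercolation (Site 2) q).real TB * (sitePercolation (Site 2) q).real TB := mul_le_mul h1 h1 hK measureReal_nonneg
      _ ≤ _ := har
  -- assemble
  have hAA : sepFourArmG r N 3 = Ap ∩ Am := by
    rw [sepFourArmG_eq_inter, hE0]
  have hsub : Ap ∩ Am ∩ (Bp ∩ Bm) ⊆ sepFourArmQ (8 * (r / 64)) N := by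
    rintro ω ⟨⟨⟨h0, h3⟩, h2, h5⟩, ⟨⟨hT0, hT3⟩, hB0, hB3⟩⟩
    simp only [Set.mem_setOf_eq, Set.mem_preimage] at h3 h2 h5 hT3 hB0 hB3
    have a3 : frameConfig 3 ω ∈ sepOpenArm (8 * (r / 64)) N := frameConfig_three_mem_sepOpenArm_of_uTurnA hr hrN h0 hT0
    have a0 : ω ∈ sepOpenArm (8 * (r / 64)) N := by
      have hT3' : frameConfig 3 ω ∈ TA := by rw [frameConfig_three_eq_rotConfig]; exact hT3
      have := frameConfig_three_mem_sepOpenArm_of_uTurnA hr hrN h3 hT3'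
      rwa [frameConfig_three_three] at this
    have a5 : frameConfig 5 ωᶜ ∈ sepOpenArm (8 * (r / 64)) N := frameConfig_five_mem_sepOpenArm_of_uTurnB hr hrN h2 hB0
    have a2 : frameConfig 2 ωᶜ ∈ sepOpenArm (8 * (r / 64)) N := by
      rw [rotConfig_compl] at hB3
      rw [frameConfig_five_eq] at h5
      have := frameConfig_five_mem_sepOpenArm_of_uTurnB hr hrN h5 hB3
      rwa [frameConfig_five_eq, rotConfig_three_three] at this
    exact ⟨a0, a2, a3, a5⟩
  have h0 : 0 ≤ (triSitePercolation p).real (sepFourArmG r N 3) := measureReal_nonneg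
  calc (triSitePercolation p).real (sepFourArmG r N 3) * ((c ^ 101) ^ 2) ^ 2
      = (triSitePercolation p).real (sepFourArmG r N 3) * ((c ^ 101) ^ 2 * (c ^ 101) ^ 2) := by ring
    _ ≤ (triSitePercolation p).real (Ap ∩ Am) * ((triSitePercolation p).real Bp * (triSitePercolation p).real Bm) := by
        rw [hAA]
        exact mul_le_mul_of_nonneg_left (mul_le_mul hBp_ge hBm_ge (pow_nonneg hK 2) measureReal_nonneg) (by rw [← hAA]; exact h0)
    _ ≤ (triSitePercolation p).real (Ap ∩ Am ∩ (Bp ∩ Bm)) := fkg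
    _ ≤ (triSitePercolation p).real (sepFourArmQ (8 * (r / 64)) N) := measureReal_mono hsub (measure_ne_top _ _)

end Literature.Probability.Percolation
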